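import Literature.Analysis.FluidPDE.HolderExtraction
import Mathlib.Analysis.InnerProductSpace.PiL2
import HarnessLib

/-!
# Crux `FiniteDissipationLiouville` (stmt-NavierStokesRegularity-22144), line `birth`:
# parabolic dilations of the slab pieces (tools for the scaling-hull files)

Helper file (theorems only, `--supports` the crux). The model of the scaling hull used by
`…RecurrentReductionDRecurrentUnif` (seat ns-lqd-p1) and by the category / minimality files of
this line (`…HullCategory*`, lead g11) restricts fields to the slab pieces
`[−(n+2), −1/(n+2)] × B̄(0, n+2)` exhausting the open past. The scaling flow acts on the pieces by
the parabolic dilations `(t, x) ↦ (l²t, l x)`; this file records that dilated pieces lie in larger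
pieces — for one factor `l > 0` (`slabPiece_mapsTo_dilate`, cf. the pointwise
`exists_slabPiece_mapsTo_dilate` of the AdaptedFrequency line) and UNIFORMLY for all factors in a
bounded range `l ∈ [1, l₀]` (`slabPiece_mapsTo_dilate_unif`), which is the equicontinuity of the
scaling flow over bounded time ranges used for the minimality of the hull
(`…HullCategoryMinimal`). No summit is proved by this file; Navier–Stokes regularity is NOT proved
by anything here. [folklore]
-/

noncomputable section

-- the summit and its single problem share the name (D-0017 nested layout)
set_option linter.dupNamespace false

namespace Summit.NavierStokesRegularity.NavierStokesRegularity.Theorems.FiniteDissipationLiouville.HullCategory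

open Set Metric Literature.Analysis.FluidPDE

/-! ### Parabolic dilations of the slab pieces -/

/-- **Dilated slab pieces lie in larger slab pieces, UNIFORMLY for factors in a bounded range**:
for every `l₀` and every piece `[−(n+2), −1/(n+2)] × B̄(0, n+2)` there is ONE piece (index
`m ≥ n`) containing the parabolic dilations `(t, x) ↦ (l²t, l x)` of the given one for every
`l ∈ [1, l₀]` (equicontinuity of the scaling flow over bounded time ranges is read off this).
[folklore] -/
theorem slabPiece_mapsTo_dilate_unif (l₀ : ℝ) (n : ℕ) :
    ∃ m : ℕ, n ≤ m ∧ ∀ l : ℝ, 1 ≤ l → l ≤ l₀ →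
      MapsTo (fun z : ℝ × EuclideanSpace ℝ (Fin 3) => ((l ^ 2 * z.1, l • z.2) : ℝ × EuclideanSpace ℝ (Fin 3)))
        (Icc (-((n : ℝ) + 2)) (-(1 / ((n : ℝ) + 2))) ×ˢ closedBall (0 : EuclideanSpace ℝ (Fin 3)) ((n : ℝ) + 2))
        (Icc (-((m : ℝ) + 2)) (-(1 / ((m : ℝ) + 2))) ×ˢ closedBall (0 : EuclideanSpace ℝ (Fin 3)) ((m : ℝ) + 2)) := by
  set N : ℝ := (n : ℝ) + 2 with hN
  have hN0 : 0 < N := by positivity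
  obtain ⟨m, hm⟩ := exists_nat_ge (l₀ ^ 2 * N + n)
  have hM0 : (0 : ℝ) < (m : ℝ) + 2 := by positivity
  refine ⟨m, ?_, fun l hl1 hll₀ z hz => ?_⟩
  · have : (n : ℝ) ≤ (m : ℝ) := by nlinarith
    exact_mod_cast this
  have hl : 0 < l := one_pos.trans_le hl1
  have hsq : l ^ 2 ≤ l₀ ^ 2 := pow_le_pow_left₀ hl.le hll₀ 2
  have hA : l ^ 2 * N ≤ (m : ℝ) + 2 := by
    have := mul_le_mul_of_nonneg_right hsq hN0.le
    linarith [n.cast_nonneg (α := ℝ)]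
  obtain ⟨⟨h1, h2⟩, h3⟩ := mem_slabPiece.1 hz
  have hlow : l ^ 2 * (-N) ≤ l ^ 2 * z.1 := mul_le_mul_of_nonneg_left h1 (by positivity)
  refine mem_slabPiece.2 ⟨⟨by linarith, ?_⟩, ?_⟩
  · have hz1 : l ^ 2 * z.1 ≤ l ^ 2 * (-(1 / N)) := mul_le_mul_of_nonneg_left h2 (by positivity)
    have hNm : 1 / ((m : ℝ) + 2) ≤ 1 / N :=
      one_div_le_one_div_of_le hN0 (by nlinarith [n.cast_nonneg (α := ℝ)])
    have h4 : l ^ 2 * (-(1 / N)) ≤ -(1 / N) := by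
      have hN1 : 0 < 1 / N := by positivity
      have hl2 : 1 ≤ l ^ 2 := by nlinarith
      nlinarith [mul_le_mul_of_nonneg_right hl2 hN1.le]
    show l ^ 2 * z.1 ≤ -(1 / ((m : ℝ) + 2))
    linarith
  · show ‖l • z.2‖ ≤ (m : ℝ) + 2
    rw [norm_smul, Real.norm_of_nonneg hl.le]
    have e1 : l * ‖z.2‖ ≤ l * N := mul_le_mul_of_nonneg_left h3 hl.le
    have hll : l ≤ l ^ 2 := by nlinarith
    have e2 : l * N ≤ l ^ 2 * N := mul_le_mul_of_nonneg_right hll hN0.le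
    linarith

/-- **Dilated slab pieces lie in larger slab pieces** (any factor `l > 0`): the parabolic
dilation `(t, x) ↦ (l²t, l x)` maps each piece `[−(n+2), −1/(n+2)] × B̄(0, n+2)` into some piece
(cf. `exists_slabPiece_mapsTo_dilate` of the AdaptedFrequency line, stated there pointwise).
[folklore] -/
theorem slabPiece_mapsTo_dilate {l : ℝ} (hl : 0 < l) (n : ℕ) :
    ∃ m : ℕ, MapsTo (fun z : ℝ × EuclideanSpace ℝ (Fin 3) => ((l ^ 2 * z.1, l • z.2) : ℝ × EuclideanSpace ℝ (Fin 3)))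
      (Icc (-((n : ℝ) + 2)) (-(1 / ((n : ℝ) + 2))) ×ˢ closedBall (0 : EuclideanSpace ℝ (Fin 3)) ((n : ℝ) + 2))
      (Icc (-((m : ℝ) + 2)) (-(1 / ((m : ℝ) + 2))) ×ˢ closedBall (0 : EuclideanSpace ℝ (Fin 3)) ((m : ℝ) + 2)) := by
  set N : ℝ := (n : ℝ) + 2 with hN
  have hN0 : 0 < N := by positivity
  have hl2 : 0 < l ^ 2 := by positivity
  have hli : 0 < (l ^ 2)⁻¹ := inv_pos.2 hl2
  obtain ⟨m, hm⟩ := exists_nat_ge ((l ^ 2 + (l ^ 2)⁻¹ + l) * N)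
  have hM0 : (0 : ℝ) < (m : ℝ) + 2 := by positivity
  have hM : (l ^ 2 + (l ^ 2)⁻¹ + l) * N ≤ (m : ℝ) + 2 := hm.trans (by linarith)
  have hA : l ^ 2 * N ≤ (m : ℝ) + 2 := le_trans (by nlinarith) hM
  have hB : (l ^ 2)⁻¹ * N ≤ (m : ℝ) + 2 := le_trans (by nlinarith) hM
  have hC : l * N ≤ (m : ℝ) + 2 := le_trans (by nlinarith) hM
  refine ⟨m, fun z hz => ?_⟩
  obtain ⟨⟨h1, h2⟩, h3⟩ := mem_slabPiece.1 hz
  refine mem_slabPiece.2 ⟨⟨by nlinarith, ?_⟩, ?_⟩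
  · have key : 1 / ((m : ℝ) + 2) ≤ l ^ 2 * (1 / N) := by
      rw [div_le_iff₀ hM0]
      calc (1 : ℝ) = l ^ 2 * (1 / N) * ((l ^ 2)⁻¹ * N) := by field_simp
        _ ≤ l ^ 2 * (1 / N) * ((m : ℝ) + 2) := mul_le_mul_of_nonneg_left hB (by positivity)
    have : l ^ 2 * z.1 ≤ l ^ 2 * (-(1 / N)) := mul_le_mul_of_nonneg_left h2 hl2.le
    show l ^ 2 * z.1 ≤ -(1 / ((m : ℝ) + 2))
    linarith
  · show ‖l • z.2‖ ≤ (m : ℝ) + 2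
    rw [norm_smul, Real.norm_of_nonneg hl.le]
    nlinarith

end Summit.NavierStokesRegularity.NavierStokesRegularity.Theorems.FiniteDissipationLiouville.HullCategory

end
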